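import Mathlib
import Summits.AtomisticToContinuum.HydrodynamicLimit.Theorems.RelayRaceLocalityNearConstantShortTimeHLMeansPinEntropy
import HarnessLib

/-!
# Crux `NearConstantShortTimeHL` (stmt-AtomisticToContinuum-12502), line `small-tilt-domination`:
# stub `klDiv_div_le_of_static`

The STATICS BOOKKEEPING of the relative-entropy method, UNIFORM IN TIME. Along a family of matched
canonical references `Q^r_N = Z_N(q_r)⁻¹ 𝟙_D q_r^{⊗ n_N} dZ`, `r ∈ S`, whose pressures
`n_N⁻¹ log Z_N(q_r)` converge uniformly on `S`, the relative entropy of the evolved canonical law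
`P_N = Z_N(p)⁻¹ 𝟙_D p^{⊗ n_N} dZ` satisfies, for every `κ > 0`, eventually in `N` and simultaneously
for all `r ∈ S`,

`KL((Φ_r)_* P_N ‖ Q^r_N) < ∞` and
`KL((Φ_r)_* P_N ‖ Q^r_N) / n_N ≤ (m^{st}(r) − E_{P_N}[∫ Λ^B_r dμ ∘ Φ_r]) + κ`.

Route: for each `N` (the partition function `Z_N(p)` is positive because `P_N` is a probability
measure) and each `r ∈ S`, `klDiv_lawAt_ne_top_and_le` (…MeansPinEntropy: entropy production
identity, `KL(P ‖ P) = 0`, Liouville invariance) gives finiteness and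
`KL ≤ ∫ log f dP_N − ∫ log g ∘ Φ_r dP_N` with `f, g` the two canonical densities, whose logarithms
on the hard-sphere domain are `n ⟨emp, Λ⟩ − log Z` (`log_canonicalDensity_of_mem`). Dividing by
`n_N` and inserting `m₀ − π₀ = m^{st}(r) − π^{st}(r)`, the error
`(E ∫Λ^A dμ − m₀) + (π₀ − n⁻¹ log Z_N(p)) + (n⁻¹ log Z_N(q_r) − π^{st}(r))` is `< κ` for `N` large,
uniformly in `r ∈ S` (`Metric.tendstoUniformlyOn_iff`).

No definitions, no named facts. References: H.-T. Yau, Lett. Math. Phys. 22 (1991) §2;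
S. Olla – S.R.S. Varadhan – H.-T. Yau, Comm. Math. Phys. 155 (1993) §3.
-/

noncomputable section

namespace Summit.AtomisticToContinuum.HydrodynamicLimit.Theorems.NearConstantShortTimeHL

open scoped BigOperators ENNReal
open MeasureTheory Set Filter
open Literature.MathematicalPhysics.KineticTheory Literature.Analysis.FluidPDE Literature.Analysis.FunctionSpaces

/-- **Yau's statics bookkeeping, uniform in time, general `(ε_N, n_N)` families.** Let `p` and
`q_r` (`r ∈ S`) be positive measurable one-particle profiles on `𝕋³ × ℝ³`, `P_N` the canonical
hard-sphere laws of `p` — assumed to be probability measures — and `Q^r_N` those of `q_r`, whose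
partition functions are positive as soon as those of `p` are nonzero. Suppose `n_N → ∞`,
`n_N⁻¹ log Z_N(p) → π₀`, `n_N⁻¹ log Z_N(q_r) → π^{st}(r)` uniformly on `S`, the empirical mean of
`Λ^A = log p` is eventually `P_N`-integrable with expectation `→ m₀`, the empirical means of
`Λ^B_r = log q_r` at time `r` are `P_N`-integrable, and `m₀ − π₀ = m^{st}(r) − π^{st}(r)` on `S`.
Then for every `κ > 0`, eventually in `N`, for all `r ∈ S`: `KL((Φ_N r)_* P_N ‖ Q^r_N)` is finite
and `KL/n_N ≤ (m^{st}(r) − E_{P_N}[mean of Λ^B_r ∘ Φ_N r]) + κ` (entropy production identity along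
the flow: `KL/n_N ≤ [E(Λ^A) − n⁻¹ log Z(p)] − [E(Λ^B_r ∘ Φ_r) − n⁻¹ log Z(q_r)]`).
[cite: Yau1991, §2] -/
theorem klDiv_div_le_of_static : ∀ {ε : ℕ → ℝ} {n : ℕ → ℕ} (Φ : (N : ℕ) → HardSphereFlow (Torus.geometry (Fin 3)) (ε N) (n N)), Tendsto n atTop atTop → ∀ {p : T3 × V3 → ℝ} {q : ℝ → T3 × V3 → ℝ} {S : Set ℝ}, Measurable p → (∀ r ∈ S, Measurable (q r)) → (∀ y, 0 < p y) → (∀ r ∈ S, ∀ y, 0 < q r y) → (∀ N, ∀ r ∈ S, canonicalPartition (Torus.geometry (Fin 3)) (ε N) (n N) p ≠ 0 → 0 < canonicalPartition (Torus.geometry (Fin 3)) (ε N) (n N) (q r)) → ∀ P : (N : ℕ) → Measure (Config (n N) (Fin 3) T3), (∀ N, P N = particleLaw (Φ N) (canonicalDensity (Torus.geometry (Fin 3)) (ε N) (n N) p)) → (∀ N, IsProbabilityMeasure (P N)) → ∀ {ΛA : T3 × V3 → ℝ} {ΛB : ℝ → T3 × V3 → ℝ}, (∀ y, Real.log (p y)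 = ΛA y) → (∀ r ∈ S, ∀ y, Real.log (q r y) = ΛB r y) → ∀ {m₀ π₀ : ℝ} {mst πst : ℝ → ℝ}, Tendsto (fun N => (n N : ℝ)⁻¹ * Real.log (canonicalPartition (Torus.geometry (Fin 3)) (ε N) (n N) p)) atTop (nhds π₀) → TendstoUniformlyOn (fun N r => (n N : ℝ)⁻¹ * Real.log (canonicalPartition (Torus.geometry (Fin 3)) (ε N) (n N) (q r))) πst atTop S → (∀ᶠ N in atTop, Integrable (fun z => ∫ y, ΛA y ∂(empiricalMeasure z)) (P N)) → Tendsto (fun N => ∫ z, (∫ y, ΛA y ∂(empiricalMeasure z)) ∂(P N)) atTop (nhds m₀) → (∀ N, ∀ r ∈ S, Integrable (fun z => ∫ y, ΛB r y ∂(empiricalMeasure ((Φ N).flow r z))) (P N)) → (∀ r ∈ S, m₀ - π₀ = mst r - πst r) → ∀ κ : ℝ, 0 < κ → ∀ᶠ N in atTop, ∀ r ∈ S, InformationTheory.klDiv ((Φ N).lawAt (P N) r) (particleLaw (Φ N) (canonicalDensity (Torus.geometry (Fin 3)) (ε N) (n N) (q r))) ≠ ⊤ ∧ (InformationTheory.klDiv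 ((Φ N).lawAt (P N) r) (particleLaw (Φ N) (canonicalDensity (Torus.geometry (Fin 3)) (ε N) (n N) (q r)))).toReal / (n N : ℝ) ≤ (mst r - ∫ z, (∫ y, ΛB r y ∂(empiricalMeasure ((Φ N).flow r z))) ∂(P N)) + κ := by
  intro ε n Φ hn p q S hpm hqm hp0 hq0 hZ P hPp hP ΛA ΛB hΛA hΛB m₀ π₀ mst πst hπ₀ hπst hm₀i hm₀ hBint hid
    κ hκ
  obtain rfl : P = fun N => particleLaw (Φ N) (canonicalDensity (Torus.geometry (Fin 3)) (ε N) (n N) p) :=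
    funext hPp
  -- notation
  set Zp : ℕ → ℝ := fun N => canonicalPartition (Torus.geometry (Fin 3)) (ε N) (n N) p with hZp
  set Zq : ℕ → ℝ → ℝ := fun N r => canonicalPartition (Torus.geometry (Fin 3)) (ε N) (n N) (q r) with hZq
  set P : (N : ℕ) → Measure (Config (n N) (Fin 3) T3) := fun N =>
    particleLaw (Φ N) (canonicalDensity (Torus.geometry (Fin 3)) (ε N) (n N) p) with hPdef
  set mA : (N : ℕ) → Config (n N) (Fin 3) T3 → ℝ := fun N z => ∫ y, ΛA y ∂(empiricalMeasure z) with hmA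
  set mB : ℝ → (N : ℕ) → Config (n N) (Fin 3) T3 → ℝ := fun r N z => ∫ y, ΛB r y ∂(empiricalMeasure z)
    with hmB
  -- the partition functions of `p` are positive (else `P N = 0` is not a probability measure)
  have hZp0 : ∀ N, 0 < Zp N := by
    intro N
    refine lt_of_le_of_ne (canonicalPartition_nonneg _ _ _ fun y => (hp0 y).le) (Ne.symm fun h0 => ?_)
    have hzero : P N = 0 := by
      simp only [hPdef, particleLaw_eq]
      have : (fun z => ENNReal.ofReal (canonicalDensity (Torus.geometry (Fin 3)) (ε N) (n N) p z)) = 0 := by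
        funext z
        simp only [canonicalDensity, Pi.zero_apply]
        rw [show canonicalPartition (Torus.geometry (Fin 3)) (ε N) (n N) p = 0 from h0, inv_zero, zero_mul,
          ENNReal.ofReal_zero]
      rw [this, withDensity_zero]
    have h1 := (hP N).measure_univ
    rw [hzero] at h1
    simp at h1
  have hZq0 : ∀ N, ∀ r ∈ S, 0 < Zq N r := fun N r hr => hZ N r hr (hZp0 N).ne'
  -- the reference laws are finite with mass at most one
  have hQ : ∀ N, ∀ r ∈ S,
      IsFiniteMeasure (particleLaw (Φ N) (canonicalDensity (Torus.geometry (Fin 3)) (ε N) (n N) (q r))) ∧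
        particleLaw (Φ N) (canonicalDensity (Torus.geometry (Fin 3)) (ε N) (n N) (q r)) univ ≤ 1 := by
    intro N r hr
    rcases NearConstantShortTimeHLNegative.particleLaw_canonicalDensity_zero_or_prob (Φ N)
      (f₀ := q r) (fun y => (hq0 r hr y).le) with h | h
    · refine ⟨?_, ?_⟩
      · rw [h]; infer_instance
      · rw [h]; simp
    · exact ⟨inferInstance, prob_le_one⟩
  -- eventually `n_N ≥ 1`
  have hn1 : ∀ᶠ N in atTop, 1 ≤ n N := hn.eventually_ge_atTop 1
  -- the per-`N` estimate, simultaneously for all `r ∈ S`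
  have hest : ∀ᶠ N in atTop, ∀ r ∈ S,
      InformationTheory.klDiv ((Φ N).lawAt (P N) r)
          (particleLaw (Φ N) (canonicalDensity (Torus.geometry (Fin 3)) (ε N) (n N) (q r))) ≠ ⊤ ∧
        (InformationTheory.klDiv ((Φ N).lawAt (P N) r)
          (particleLaw (Φ N) (canonicalDensity (Torus.geometry (Fin 3)) (ε N) (n N) (q r)))).toReal ≤
          (n N : ℝ) * (∫ z, mA N z ∂(P N)) - Real.log (Zp N) -
            (n N : ℝ) * (∫ z, mB r N ((Φ N).flow r z) ∂(P N)) + Real.log (Zq N r) := by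
    filter_upwards [hn1, hm₀i] with N hN1 hAint r hr
    have hBint1 := hBint N r hr
    have hn0 : n N ≠ 0 := by omega
    haveI hXE : SigmaFinite (volume : Measure (T3 × V3)) := inferInstance
    haveI hC : SigmaFinite (volume : Measure (Config (n N) (Fin 3) T3)) := inferInstance
    haveI hL : SigmaFinite (liouville (Torus.geometry (Fin 3)) (n N) (ε N)) := by
      rw [liouville_eq]; infer_instance
    set f : Config (n N) (Fin 3) T3 → ℝ≥0∞ := fun z =>
      ENNReal.ofReal (canonicalDensity (Torus.geometry (Fin 3)) (ε N) (n N) p z) with hf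
    set g : Config (n N) (Fin 3) T3 → ℝ≥0∞ := fun z =>
      ENNReal.ofReal (canonicalDensity (Torus.geometry (Fin 3)) (ε N) (n N) (q r) z) with hg
    have hPf : P N = (liouville (Torus.geometry (Fin 3)) (n N) (ε N)).withDensity f := rfl
    have hQg : particleLaw (Φ N) (canonicalDensity (Torus.geometry (Fin 3)) (ε N) (n N) (q r)) =
        (liouville (Torus.geometry (Fin 3)) (n N) (ε N)).withDensity g := rfl
    have hfm : Measurable f := (measurable_canonicalDensity (ε N) (n N) hpm).ennreal_ofReal
    have hgm : Measurable g := (measurable_canonicalDensity (ε N) (n N) (hqm r hr)).ennreal_ofReal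
    haveI : IsProbabilityMeasure ((liouville (Torus.geometry (Fin 3)) (n N) (ε N)).withDensity f) := hP N
    haveI : IsFiniteMeasure ((liouville (Torus.geometry (Fin 3)) (n N) (ε N)).withDensity g) :=
      (hQ N r hr).1
    have hD := ae_restrict_mem (μ := (volume : Measure (Config (n N) (Fin 3) T3)))
      (measurableSet_hardSphereDomain (Torus.geometry (Fin 3)) Torus.measurable_geometry_sepVec (n N) (ε N))
    rw [← liouville_eq] at hD
    have hf0 : ∀ᵐ z ∂liouville (Torus.geometry (Fin 3)) (n N) (ε N), f z ≠ 0 := by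
      filter_upwards [hD] with z hz
      exact (ENNReal.ofReal_pos.2 (canonicalDensity_pos_of_mem hp0 (hZp0 N) hz)).ne'
    have hg0 : ∀ᵐ z ∂liouville (Torus.geometry (Fin 3)) (n N) (ε N), g z ≠ 0 := by
      filter_upwards [hD] with z hz
      exact (ENNReal.ofReal_pos.2 (canonicalDensity_pos_of_mem (hq0 r hr) (hZq0 N r hr) hz)).ne'
    set A : Config (n N) (Fin 3) T3 → ℝ := fun z => (n N : ℝ) * mA N z - Real.log (Zp N) with hA
    set B : Config (n N) (Fin 3) T3 → ℝ := fun z => (n N : ℝ) * mB r N z - Real.log (Zq N r) with hB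
    have hlogA : ∀ᵐ z ∂liouville (Torus.geometry (Fin 3)) (n N) (ε N), Real.log (f z).toReal = A z := by
      filter_upwards [hD] with z hz
      rw [hf, hA, hmA]
      dsimp only
      rw [ENNReal.toReal_ofReal (canonicalDensity_pos_of_mem hp0 (hZp0 N) hz).le,
        log_canonicalDensity_of_mem hn0 hp0 (hZp0 N) hz]
      simp_rw [hΛA]
      rfl
    have hlogB : ∀ᵐ z ∂liouville (Torus.geometry (Fin 3)) (n N) (ε N), Real.log (g z).toReal = B z := by
      filter_upwards [hD] with z hz
      rw [hg, hB, hmB]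
      dsimp only
      rw [ENNReal.toReal_ofReal (canonicalDensity_pos_of_mem (hq0 r hr) (hZq0 N r hr) hz).le,
        log_canonicalDensity_of_mem hn0 (hq0 r hr) (hZq0 N r hr) hz]
      simp_rw [hΛB r hr]
      rfl
    have hAi : Integrable A ((liouville (Torus.geometry (Fin 3)) (n N) (ε N)).withDensity f) := by
      rw [← hPf]
      exact (hAint.const_mul _).sub (integrable_const _)
    have hBi : Integrable (fun z => B ((Φ N).flow r z))
        ((liouville (Torus.geometry (Fin 3)) (n N) (ε N)).withDensity f) := by
      rw [← hPf]
      exact (hBint1.const_mul _).sub (integrable_const _)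
    obtain ⟨htop, hle⟩ := klDiv_lawAt_ne_top_and_le (Φ N) hfm hgm hf0 (fun z => ENNReal.ofReal_ne_top) hg0
      (fun z => ENNReal.ofReal_ne_top) (by rw [← hQg]; exact (hQ N r hr).2) r hlogA hlogB hAi hBi
    rw [← hPf, ← hQg] at htop hle
    refine ⟨htop, hle.trans (le_of_eq ?_)⟩
    rw [hA, hB]
    dsimp only
    rw [integral_sub (hAint.const_mul _) (integrable_const _),
      integral_sub (hBint1.const_mul _) (integrable_const _), integral_const_mul, integral_const_mul,
      integral_const, integral_const, probReal_univ, one_smul, one_smul]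
    ring
  -- the three convergences at precision `κ / 3`, the third one uniformly on `S`
  have hκ3 : 0 < κ / 3 := by positivity
  have h1 : ∀ᶠ N in atTop, dist (∫ z, mA N z ∂(P N)) m₀ < κ / 3 := Metric.tendsto_nhds.1 hm₀ _ hκ3
  have h2 : ∀ᶠ N in atTop, dist ((n N : ℝ)⁻¹ * Real.log (Zp N)) π₀ < κ / 3 :=
    Metric.tendsto_nhds.1 hπ₀ _ hκ3
  have h3 : ∀ᶠ N in atTop, ∀ r ∈ S, dist (πst r) ((n N : ℝ)⁻¹ * Real.log (Zq N r)) < κ / 3 :=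
    Metric.tendstoUniformlyOn_iff.1 hπst _ hκ3
  filter_upwards [hest, hn1, h1, h2, h3] with N hN hN1 hN2 hN3 hN4 r hr
  obtain ⟨htop, hle⟩ := hN r hr
  refine ⟨htop, ?_⟩
  have hnpos : (0 : ℝ) < n N := by exact_mod_cast hN1
  have hN4r := hN4 r hr
  rw [Real.dist_eq, abs_sub_lt_iff] at hN2 hN3 hN4r
  obtain ⟨hx1, -⟩ := hN2
  obtain ⟨-, ha2⟩ := hN3
  obtain ⟨-, hb2⟩ := hN4r
  have ha : (n N : ℝ) * ((n N : ℝ)⁻¹ * Real.log (Zp N)) = Real.log (Zp N) :=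
    mul_inv_cancel_left₀ hnpos.ne' _
  have hb : (n N : ℝ) * ((n N : ℝ)⁻¹ * Real.log (Zq N r)) = Real.log (Zq N r) :=
    mul_inv_cancel_left₀ hnpos.ne' _
  have hsum : (∫ z, mA N z ∂(P N)) - (n N : ℝ)⁻¹ * Real.log (Zp N) + (n N : ℝ)⁻¹ * Real.log (Zq N r) ≤
      mst r + κ := by linarith [hid r hr]
  have hprod := mul_le_mul_of_nonneg_left hsum hnpos.le
  rw [mul_add, mul_add, mul_sub, ha, hb] at hprod
  rw [div_le_iff₀ hnpos]
  linarith

end Summit.AtomisticToContinuum.HydrodynamicLimit.Theorems.NearConstantShortTimeHL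

end
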